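import Summits.ABC.IUTFork.Joshi.TestRealPinsEquivarianceRamified
import Summits.ABC.IUTFork.Thm311RealIsmDHMoverInitialThetaData
import HarnessLib

/-!
# Branch E TEST vs S — the (hρ)-EQUIVARIANT PIN AT THE HONEST REAL SETTING over the Dupuy–Hilado (Ind2), III:
# the MOVER-ABSTRACTED form, and the place-free refutation over EVERY number field containing √−1
# (i.e. over the field of EVERY initial Θ-datum, [IUTchI] Def. 3.1 (a)) — reader's companion

Proof-only READER'S COMPANION, sequel of `Joshi/TestRealPinsEquivarianceRamified.lean` (p446546; abc-iut-E-t16 gen 5, RQ7 reader of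
abc-iut-E-t41's p445387 = hand item (a′) of abc-iut-E-cx-2; the GENUINE-carrier twin is abc-iut-E-t44's p446474
`TestGenuinePinsVacuityRamified`, whose dyadic input this file transports to the honest setting). Every input BY NAME; nothing restated.
**No side is taken** on [IUTchIII] Cor. 3.12 or on any author (Mochizuki / Scholze–Stix / Joshi / Dupuy–Hilado); typed ≠ proved ≠
endorsed; located, not adjudicated. R14: `Joshi/Test*`. 0 `def`, 0 `instance`, no notation, no `Prop` fact; standard axioms.

WHAT THIS FILE ADDS (kernel).
* `RamifiedPins.not_pinnedRegions_honestSetting_DH_of_mover` — E-t41's steps §b–§f with step §a ABSTRACTED: ANY Dupuy–Hilado (Ind2)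
  element `g` at ONE finite place `v₀ ∣ p₀` moving the unit ball `𝒪_{v₀}` (w5-d216's currency
  `(toR ∘ g ∘ ofR) '' closedBall 0 1 ≠ closedBall 0 1`) refutes `PinnedRegions` at `honestSetting` over (`stripAutDH`, `ismDH`), for every
  column family, column, box prime, auxiliary data, `ρ`, `qK` — ANY prime `p₀` (2 included), bad places above it or not.
* `…_of_dyadic_of_sq_eq_neg_one` — `√−1 ∈ F`, ANY place `v₀ ∣ 2`: the mover is abc-iut-w5-d039's
  `Thm311.Real.exists_mem_ismDH_image_closedBall_one_ne_of_exists_sq_eq_neg_one` (`Thm311RealIsmDHMoverInitialThetaData`).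
* **`…_of_sq_eq_neg_one` — PLACE-FREE: for EVERY number field `F ∋ √−1`** — in particular for the field of EVERY initial Θ-datum
  ([IUTchI] Def. 3.1 (a), render `book:anonnd-inter-universal-teichmuller-theory-i` p0061 l.15 «F is a number field such that √−1 ∈ F») —
  and ALL remaining data: `¬ PinnedRegions` at `honestSetting` over the Dupuy–Hilado binders (a place over `2` always exists,
  `CyclotomicBoundary.exists_place_over`). Consequence for the record, as p445387/p446546 say: the «(hρ)-pins ⟹ …» S-form theorems at
  `honestSetting`/(DH) are VACUOUS over every initial-Θ-datum field AS TYPED ((hρ) at all labels incl. `j = 0` ∧ DH's full (Ind2) ∧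
  `𝒪_L`-boxes at `j = 0`); the region-pin (IndCoversQ) results are untouched; the repairs listed in p445387 each defeat this witness.
* `…_of_five_le'` — p446546's ramified form RE-DERIVED from the mover form (consistency).
[claim: Mochizuki2012, status: disputed] [cite: Mochizuki2012, IUTchI Def. 3.1 (a)] [cite: DupuyHilado2025, §4.9]
-/

noncomputable section

open Metric Set Function NumberField IsDedekindDomain
open scoped Pointwise

namespace Summit.ABC.IUTFork.Joshi.RamifiedPins

open Summit.ABC.IUTFork.Joshi Summit.ABC.IUTFork
open Thm311 Thm311.Real Cor312 Cor312Vol Literature.IUT.LogThetaLattice Literature.IUT.LogVolume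
open Literature.NumberTheory.NumberFields Literature.NumberTheory.GaloisRepresentations.Ultrametric

variable {F : Type} [Field F] [NumberField F] (X : PilotData F) {logv : PadicLogs F} (hlog : LogvAnalytic logv)
  (M : Type) [Field M] [NumberField M]
  (archPk : ∀ (j : (thetaIndex X).Label) (vQ : (thetaIndex X).VQ), Set ((logShellsDH X logv).Packet j vQ))
  (archSub : ∀ (j : (thetaIndex X).Label) (v : (thetaIndex X).V), Set ((logShellsDH X logv).Packet j ((thetaIndex X).over v)))
  (Ψ : ℤ → ∀ v : (thetaIndex X).V, v ∈ (thetaIndex X).Vbad → Set ((logShellsDH X logv).StarPacket v))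
  (act : ℤ → ∀ v : (thetaIndex X).V, v ∈ (thetaIndex X).Vbad →
    (logShellsDH X logv).StarPacket v → Module.End ℚ ((logShellsDH X logv).StarPacket v))
  (Mmod : ℤ → ∀ j : (thetaIndex X).LabelStar, Set ((logShellsDH X logv).GlobalPacket j.1))
  (region : ℤ → ∀ j : (thetaIndex X).LabelStar, FinDivisor M → ∀ vQ : (thetaIndex X).VQ, Set ((logShellsDH X logv).Packet j.1 vQ))
  (col : ℤ → Column (logShellsDH X logv)) (n : ℤ) (p : ℕ)

/-- **`not_pinnedRegions_honestSetting_DH_of_mover` — ONE Dupuy–Hilado (Ind2) mover of `𝒪_{v₀}` at ONE finite place refutes the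
(hρ)-equivariant pin at the honest setting** (any prime `p₀`, bad places above it or not; every column family, column, box prime,
auxiliary data, `ρ`, `qK`). Proof: abc-iut-E-t41's p445387 §b–§f verbatim (zero-label (Ind2)-generator «`g` at `v₀`, identity
elsewhere; identity at labels `≠ 0`» — trivial on every star packet, hence (p441977) stabilising `e⁻¹(𝒪_L)` at `(0, p₀)`, yet carrying
the test vector `⊗(z at v₀, 0 elsewhere)` to `⊗(g z, …)`), with the mover now a HYPOTHESIS. Located, not adjudicated; honest reading as
in p445387. [claim: Mochizuki2012, status: disputed] [cite: DupuyHilado2025, §4.9] -/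
theorem not_pinnedRegions_honestSetting_DH_of_mover (pp : Nat.Primes) (v₀ : HeightOneSpectrum (𝓞 F))
    (hv₀ : (thetaIndex X).over (.inr v₀) = .inr pp)
    (hmover : haveI : Fact (pp : ℕ).Prime := ⟨pp.2⟩
      ∃ g ∈ ismDH logv (.inr v₀ : Thm311.Real.Place F),
        (fun a => toR (pp : ℕ) v₀ (natCast_mem_placeOf X pp ⟨.inr v₀, hv₀⟩)
            (g (ofR (pp : ℕ) v₀ (natCast_mem_placeOf X pp ⟨.inr v₀, hv₀⟩) a))) ''
            closedBall (0 : RescaledCompletion F (pp : ℕ) v₀ (natCast_mem_placeOf X pp ⟨.inr v₀, hv₀⟩)) 1 ≠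
          closedBall 0 1)
    (ρ : (∀ v : (thetaIndex X).V, v ∈ (thetaIndex X).Vbad → Set ((logShellsDH X logv).StarPacket v)) →
      ∀ (j : (thetaIndex X).Label) (vQ : (thetaIndex X).VQ), Set ((logShellsDH X logv).Packet j vQ))
    (qK : ∀ v : (thetaIndex X).V, v ∈ (thetaIndex X).Vbad → Set ((logShellsDH X logv).StarPacket v)) :
    ¬ Summit.ABC.IUTFork.Cor312Vol.PinnedRegions (latticeSituationReal X hlog stripAutDH (ismDH logv) refl_mem_stripAutDH
        (refl_mem_ismDH logv) M archPk archSub Ψ act Mmod region col)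
      (honestSetting X hlog stripAutDH (ismDH logv) refl_mem_stripAutDH (refl_mem_ismDH logv) M archPk archSub Ψ act Mmod
        region col n p) ρ qK := by
  classical
  intro hpin
  haveI hpF : Fact (pp : ℕ).Prime := ⟨pp.2⟩
  let L := logShellsDH X logv
  set x₀ : (thetaIndex X).Fibre (.inr pp) := ⟨.inr v₀, hv₀⟩ with hx₀def
  set P := presAt X hlog pp
  have hlab : (((0 : (thetaIndex X).Label)) : ℕ) = 0 := Fin.val_zero _
  have hv : ((pp : ℕ) : 𝓞 F) ∈ v₀.asIdeal := natCast_mem_placeOf X pp x₀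
  -- §a. the GIVEN mover of the unit ball `𝒪_{v₀}` inside Dupuy–Hilado's (Ind2)
  obtain ⟨g, hg, hmov⟩ := hmover
  -- the moved unit ball, read on the carrier `Carrier (.inr v₀)` (= `K_{v₀}^{(1/n)}` as a type; `toR`/`ofR` are the identity)
  let Bc : Set (Carrier (.inr v₀ : Thm311.Real.Place F)) := {z | ‖toR (pp : ℕ) v₀ hv z‖ ≤ 1}
  have hmem_Bc : ∀ z : Carrier (.inr v₀ : Thm311.Real.Place F), z ∈ Bc ↔ ‖toR (pp : ℕ) v₀ hv z‖ ≤ 1 := fun z => Iff.rfl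
  have hgBc : ⇑g '' Bc ≠ Bc := by
    intro h
    apply hmov
    have hBc2 : (closedBall (0 : RescaledCompletion F (pp : ℕ) v₀ hv) 1) = Bc := by
      ext a
      rw [mem_closedBall_zero_iff]
      exact Iff.rfl
    rw [hBc2]
    exact h
  -- §b. the ZERO-LABEL (Ind2)-generator: `g` at `v₀`, identity at the other places; identity at every nonzero label
  let gPl : ∀ y : Thm311.Real.Place F, Carrier y ≃ₗ[ℚ] Carrier y := fun y =>
    if h : y = .inr v₀ then (by subst h; exact g) else LinearEquiv.refl ℚ (Carrier y)
  have hgPl_v₀ : gPl (.inr v₀) = g := by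
    show (if h : (Sum.inr v₀ : Thm311.Real.Place F) = .inr v₀ then _ else _) = g
    rw [dif_pos rfl]
  have hgPl_mem : ∀ y : Thm311.Real.Place F, gPl y ∈ ismDH logv y := by
    intro y
    by_cases hy : y = .inr v₀
    · subst hy; rw [hgPl_v₀]; exact hg
    · show (if h : y = .inr v₀ then _ else _) ∈ _
      rw [dif_neg hy]; exact refl_mem_ismDH _ y
  let Φ₀ : L.PacketAut := fun j vQ =>
    if j = 0 then L.factorwise j vQ fun _ => L.summandwise vQ fun v => gPl v.1 else LinearEquiv.refl ℚ _
  have hΦ₀_zero : ∀ vQ, Φ₀ 0 vQ = L.factorwise 0 vQ fun _ => L.summandwise vQ fun v => gPl v.1 := fun vQ => if_pos rfl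
  have hΦ₀_ne : ∀ (j : (thetaIndex X).Label) (vQ), j ≠ 0 → Φ₀ j vQ = LinearEquiv.refl ℚ _ := fun j vQ hj0 => if_neg hj0
  have hΦ₀ : Φ₀ ∈ L.Ind2Family := by
    intro j vQ
    by_cases hj0 : j = 0
    · subst hj0
      exact ⟨fun _ v => gPl v.1, fun _ v => hgPl_mem v.1, hΦ₀_zero vQ⟩
    · rw [show Φ₀ j vQ = LinearEquiv.refl ℚ _ from hΦ₀_ne j vQ hj0]
      exact L.refl_mem_Ind2 j vQ
  have hΦ₀c : Φ₀ ∈ Subgroup.closure (L.Ind1Family ∪ L.Ind2Family) := Subgroup.subset_closure (Or.inr hΦ₀)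
  -- it acts TRIVIALLY on every star packet (labels `j ≠ 0` only)
  have hid : ∀ (v : (thetaIndex X).V), v ∈ (thetaIndex X).Vbad → L.starAut Φ₀ v = LinearEquiv.refl ℚ _ := by
    intro v _
    refine LinearEquiv.ext fun f => funext fun j => ?_
    show (Φ₀ j.1 ((thetaIndex X).over v)) (f j) = f j
    rw [hΦ₀_ne j.1 _ j.2]
    rfl
  -- §c. hence (p441977) it stabilises the `q`-image `e⁻¹(𝒪_L)` at the packet `(0, p₀)`
  have hEq := (honestSetting_images_stable_of_pinnedRegions X hlog stripAutDH (ismDH logv) refl_mem_stripAutDH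
    (refl_mem_ismDH logv) M archPk archSub Ψ act Mmod region col n p hpin hΦ₀c hid 0 0 (.inr pp)).2
  rw [honestSetting_qRegion, preimage_factorMapDH_hullSet_one X hlog 0 pp] at hEq
  -- §d. test vectors `⊗(z at v₀, 0 elsewhere)`; membership in `e⁻¹(Π (R_{v⃗})^∼)` reads `‖z‖ ≤ 1`
  let y1 : Carrier (.inr v₀ : Thm311.Real.Place F) → L.Packet1 (.inr pp) := fun z => Pi.single x₀ z
  have hy1_x₀ : ∀ z, y1 z x₀ = z := fun z => Pi.single_eq_same _ _
  have hy1_ne : ∀ z (v : (thetaIndex X).Fibre (.inr pp)), v ≠ x₀ → y1 z v = 0 := fun z v hv' => Pi.single_eq_of_ne hv' _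
  let xz : Carrier (.inr v₀ : Thm311.Real.Place F) → L.Packet 0 (.inr pp) := fun z => L.tprod 0 (.inr pp) fun _ => y1 z
  -- `φ_{v₀} = id`: the presentation coordinate of `z` IS `z`, with the rescaled norm
  have hφx₀ : ∀ z : Carrier (.inr v₀ : Thm311.Real.Place F), ‖P.φ x₀ z‖ = ‖toR (pp : ℕ) v₀ hv z‖ := fun z => rfl
  have hall : ∀ z, z ∈ Bc → ∀ v : (thetaIndex X).Fibre (.inr pp), ‖P.φ v (y1 z v)‖ ≤ 1 := by
    intro z hz v
    by_cases hv' : v = x₀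
    · subst hv'
      rw [hy1_x₀, hφx₀]
      exact hz
    · rw [hy1_ne z v hv', map_zero, norm_zero]
      exact zero_le_one
  have hmem_xz : ∀ z, xz z ∈ P.comparison 0 ⁻¹' (Set.pi univ fun ev =>
      (normalizedPacket pp.1 (P.kk ev) : Set (P.X ev))) ↔ z ∈ Bc := by
    intro z
    rw [hmem_Bc, Set.mem_preimage, Set.mem_univ_pi]
    constructor
    · intro h
      have h0 := h (fun _ => x₀)
      rw [show P.comparison 0 (xz z) (fun _ => x₀) = _ from P.comparison_tprod 0 (fun _ => y1 z) (fun _ => x₀),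
        IsmDHMover.tprod_eq_iota_last _ hlab, SetLike.mem_coe,
        IsmDHMover.mem_normalizedPacket_iff_norm_dEquiv_le] at h0
      obtain ⟨i⟩ := nonempty_dIdx pp.1 (P.kk fun _ : (thetaIndex X).Caps 0 => x₀)
      have h1 := h0 i
      rw [norm_dEquiv_iota, hy1_x₀, hφx₀] at h1
      exact h1
    · intro hz ev
      rw [show P.comparison 0 (xz z) ev = _ from P.comparison_tprod 0 (fun _ => y1 z) ev,
        IsmDHMover.tprod_eq_iota_last _ hlab, SetLike.mem_coe, IsmDHMover.mem_normalizedPacket_iff_norm_dEquiv_le]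
      intro i
      rw [norm_dEquiv_iota]
      exact hall z hz (ev (Fin.last _))
  -- §e. the generator acts on the test vectors by `g` at `v₀`
  have hΦxz : ∀ z, Φ₀ 0 (.inr pp) (xz z) = xz (g z) := by
    intro z
    rw [hΦ₀_zero]
    show L.factorwise 0 (.inr pp) (fun _ => L.summandwise (.inr pp) fun v => gPl v.1)
        (L.tprod 0 (.inr pp) fun _ => y1 z) = L.tprod 0 (.inr pp) fun _ => y1 (g z)
    rw [L.factorwise_summandwise_tprod]
    congr 1
    funext a v
    by_cases hv' : v = x₀
    · rw [hv', hy1_x₀, hy1_x₀]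
      show gPl (.inr v₀) z = g z
      rw [hgPl_v₀]
    · rw [hy1_ne z _ hv', hy1_ne (g z) _ hv', map_zero]
  -- §f. contradiction: `Φ₀` does not map `e⁻¹(Π (R)^∼)` onto itself
  have key : ∀ x, x ∈ _ ↔ Φ₀ 0 (.inr pp) x ∈ _ := fun x =>
    ((Φ₀ 0 (.inr pp)).injective.mem_set_image).symm.trans (Set.ext_iff.mp hEq (Φ₀ 0 (.inr pp) x))
  rcases IsmDHMover.exists_of_image_ne g.toEquiv hgBc with ⟨z, hz, hgz⟩ | ⟨z, hz, hgz⟩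
  · have h1 : Φ₀ 0 (.inr pp) (xz z) ∈ _ := (key (xz z)).mp ((hmem_xz z).mpr hz)
    have h2 := (hΦxz z) ▸ h1
    exact hgz ((hmem_xz (g z)).mp h2)
  · have h1 : xz (g z) ∈ _ := (hmem_xz (g z)).mpr hgz
    have h2 := (hΦxz z).symm ▸ h1
    exact hz ((hmem_xz z).mp ((key (xz z)).mpr h2))



/-- **`√−1 ∈ F`, ANY place `v₀ ∣ 2`**: the (hρ)-equivariant pin at `honestSetting` over (`stripAutDH`, `ismDH`) is refuted — mover from
abc-iut-w5-d039's `exists_mem_ismDH_image_closedBall_one_ne_of_exists_sq_eq_neg_one` (at `p = 2`, `√−1 ∈ F_v` forces `𝒪_v ≠ 2^k·log_2(𝒪_v^×)`).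
[claim: Mochizuki2012, status: disputed] [cite: Mochizuki2012, IUTchI Def. 3.1 (a)] [cite: DupuyHilado2025, §4.9] -/
theorem not_pinnedRegions_honestSetting_DH_of_dyadic_of_sq_eq_neg_one (hF : ∃ i : F, i ^ 2 = -1)
    (v₀ : HeightOneSpectrum (𝓞 F)) (hv₀ : (thetaIndex X).over (.inr v₀) = .inr ⟨2, Nat.prime_two⟩)
    (ρ : (∀ v : (thetaIndex X).V, v ∈ (thetaIndex X).Vbad → Set ((logShellsDH X logv).StarPacket v)) →
      ∀ (j : (thetaIndex X).Label) (vQ : (thetaIndex X).VQ), Set ((logShellsDH X logv).Packet j vQ))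
    (qK : ∀ v : (thetaIndex X).V, v ∈ (thetaIndex X).Vbad → Set ((logShellsDH X logv).StarPacket v)) :
    ¬ Summit.ABC.IUTFork.Cor312Vol.PinnedRegions (latticeSituationReal X hlog stripAutDH (ismDH logv) refl_mem_stripAutDH
        (refl_mem_ismDH logv) M archPk archSub Ψ act Mmod region col)
      (honestSetting X hlog stripAutDH (ismDH logv) refl_mem_stripAutDH (refl_mem_ismDH logv) M archPk archSub Ψ act Mmod
        region col n p) ρ qK :=
  haveI : Fact (Nat.Prime 2) := ⟨Nat.prime_two⟩
  not_pinnedRegions_honestSetting_DH_of_mover X hlog M archPk archSub Ψ act Mmod region col n p ⟨2, Nat.prime_two⟩ v₀ hv₀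
    (exists_mem_ismDH_image_closedBall_one_ne_of_exists_sq_eq_neg_one (hlog ⟨2, Nat.prime_two⟩) v₀ _ rfl hF) ρ qK

/-- **PLACE-FREE: for EVERY number field `F ∋ √−1`** — the field of every initial Θ-datum ([IUTchI] Def. 3.1 (a)) — and ALL remaining
data (pilot datum, logarithm family, auxiliary data, column family, column, box prime, `ρ`, `qK`): `¬ PinnedRegions` at `honestSetting`
over the Dupuy–Hilado binders (a place `v₀ ∣ 2` exists, `CyclotomicBoundary.exists_place_over`; `over (.inr v₀) = .inr 2` by `rfl` through
`residueChar_eq_of_natCast_mem`). Located, not adjudicated: a statement about OUR typing ((hρ) at all labels ∧ DH's full (Ind2) ∧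
`𝒪_L`-boxes at `j = 0`), with the repairs of p445387. [claim: Mochizuki2012, status: disputed] [cite: Mochizuki2012, IUTchI Def. 3.1 (a)] -/
theorem not_pinnedRegions_honestSetting_DH_of_sq_eq_neg_one (hF : ∃ i : F, i ^ 2 = -1)
    (ρ : (∀ v : (thetaIndex X).V, v ∈ (thetaIndex X).Vbad → Set ((logShellsDH X logv).StarPacket v)) →
      ∀ (j : (thetaIndex X).Label) (vQ : (thetaIndex X).VQ), Set ((logShellsDH X logv).Packet j vQ))
    (qK : ∀ v : (thetaIndex X).V, v ∈ (thetaIndex X).Vbad → Set ((logShellsDH X logv).StarPacket v)) :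
    ¬ Summit.ABC.IUTFork.Cor312Vol.PinnedRegions (latticeSituationReal X hlog stripAutDH (ismDH logv) refl_mem_stripAutDH
        (refl_mem_ismDH logv) M archPk archSub Ψ act Mmod region col)
      (honestSetting X hlog stripAutDH (ismDH logv) refl_mem_stripAutDH (refl_mem_ismDH logv) M archPk archSub Ψ act Mmod
        region col n p) ρ qK := by
  haveI : Fact (Nat.Prime 2) := ⟨Nat.prime_two⟩
  obtain ⟨v₀, hv⟩ := CyclotomicBoundary.exists_place_over F (p := 2)
  refine not_pinnedRegions_honestSetting_DH_of_dyadic_of_sq_eq_neg_one X hlog M archPk archSub Ψ act Mmod region col n p hF v₀ ?_ ρ qK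
  show (Sum.inr ⟨residueChar F v₀, residueChar_prime F v₀⟩ : RatPlace) = Sum.inr ⟨2, Nat.prime_two⟩
  exact congrArg Sum.inr (Subtype.ext (residueChar_eq_of_natCast_mem 2 hv))

/-- **p446546's ramified form RE-DERIVED from the mover form** (every ramified `v₀ ∣ p₀`, `p₀ ≥ 5`; w5-d216's census mover) — consistency
of the two companions. [claim: Mochizuki2012, status: disputed] -/
theorem not_pinnedRegions_honestSetting_DH_of_five_le' (pp : Nat.Primes) (hp5 : 5 ≤ (pp : ℕ)) (v₀ : HeightOneSpectrum (𝓞 F))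
    (hv₀ : (thetaIndex X).over (.inr v₀) = .inr pp) (he2 : 2 ≤ v₀.asIdeal.ramificationIdx ℤ)
    (ρ : (∀ v : (thetaIndex X).V, v ∈ (thetaIndex X).Vbad → Set ((logShellsDH X logv).StarPacket v)) →
      ∀ (j : (thetaIndex X).Label) (vQ : (thetaIndex X).VQ), Set ((logShellsDH X logv).Packet j vQ))
    (qK : ∀ v : (thetaIndex X).V, v ∈ (thetaIndex X).Vbad → Set ((logShellsDH X logv).StarPacket v)) :
    ¬ Summit.ABC.IUTFork.Cor312Vol.PinnedRegions (latticeSituationReal X hlog stripAutDH (ismDH logv) refl_mem_stripAutDH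
        (refl_mem_ismDH logv) M archPk archSub Ψ act Mmod region col)
      (honestSetting X hlog stripAutDH (ismDH logv) refl_mem_stripAutDH (refl_mem_ismDH logv) M archPk archSub Ψ act Mmod
        region col n p) ρ qK :=
  haveI : Fact (pp : ℕ).Prime := ⟨pp.2⟩
  not_pinnedRegions_honestSetting_DH_of_mover X hlog M archPk archSub Ψ act Mmod region col n p pp v₀ hv₀
    (exists_mem_ismDH_image_closedBall_one_ne_of_five_le (hlog pp) v₀ _ hp5 he2) ρ qK

end Summit.ABC.IUTFork.Joshi.RamifiedPins

end
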